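import Summits.AtomisticToContinuum.BoseEinsteinCondensation.Theorems.BECInsertionCorrectorCorrectorClosureResponseDictionary
import Literature.MathematicalPhysics.QuantumManyBody.PeriodicBoseGasImpurityTranslation
import Literature.MathematicalPhysics.QuantumManyBody.PeriodicFeynmanKacFreeForm
import HarnessLib

/-!
# Crux `CorrectorClosure` (stmt-AtomisticToContinuum-12058), line `healing-scale-kac-insertion` —
# registered sub-goal `responseDictionary_sin`: the sine-mode dictionary

Supports (does not close) stmt-AtomisticToContinuum-12058, route `BECInsertionCorrector`. The
landed stub `stub_responseDictionary` (`…ResponseDictionary.lean`) turns K1 (`StaticResponseBound`,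
an energy-currency bound for the COSINE density waves `∑ⱼ cos(p·xⱼ)`) into the Kipnis–Varadhan
bound `hMinusOneSqW L Θ₀ (∑ⱼ cos(p·xⱼ)) ≤ C N / max(ρ'a, |p|²)` for the torus Feynman–Kac ground
state `Θ₀` of the bath. The heart of the line decomposes the Kac source into tagged-coordinate
modes `cos(p·y)∑ⱼcos(p·xⱼ) + sin(p·y)∑ⱼsin(p·xⱼ)`, so it also needs the SINE modes. This file
supplies them with the same constant:

* `staticResponse_sin_of_cos` — **the quarter-wavelength translation.** If the energy-currency
  response bound `E₀ - C_K t² ≤ E(Ψ) + t ∫_cell (∑ⱼ cos(p·xⱼ))|Ψ|²` holds for all `t` and all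
  finite-energy periodic trial states `Ψ` in the box `L` (`p = 2πk/L`, `k ≠ 0`), then so does the
  same bound with `sin` in place of `cos`: translate all bosons by `s = (L/4|k|²) k` (`p·s = π/2`,
  `PeriodicTrialState.exists_translate`, same energy by `periodicEnergy_translate`), apply the
  cosine bound at coupling `-t` to the translate, and shift the cell integral back
  (`setIntegral_cellN_comp_add_of_periodic`, `cos(θ + π/2) = -sin θ`).
* `responseDictionary_sin` — the registered sub-goal: verbatim the statement of
  `stub_responseDictionary` with `Real.sin` for `Real.cos`, reduced to
  `ResponseDictionary.hMinusOneSqW_le_of_fk_staticResponse` exactly as the cosine stub is, the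
  hypothesis `hK` being supplied by `staticResponse_sin_of_cos`.
-/

noncomputable section

open MeasureTheory Filter
open scoped ENNReal NNReal BigOperators

namespace Summit.AtomisticToContinuum.BoseEinsteinCondensation.Theorems.CorrectorClosure.HealingScaleKacInsertion.ResponseDictionary

open Literature.MathematicalPhysics.QuantumManyBody.BoseGas

variable {N : ℕ}

/-! ### The phase `p·x` under translations -/

/-- `p·(x + y) = p·x + p·y` for the phase `p·x = (2π/L)∑ᵢ kᵢxᵢ`. [folklore] -/
theorem phase_add (L : ℝ) (k : Fin 3 → ℤ) (x y : Space) :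
    2 * Real.pi / L * ∑ i, (k i : ℝ) * (x + y) i =
      2 * Real.pi / L * ∑ i, (k i : ℝ) * x i + 2 * Real.pi / L * ∑ i, (k i : ℝ) * y i := by
  rw [← mul_add, ← Finset.sum_add_distrib]
  congr 1
  refine Finset.sum_congr rfl fun i _ => ?_
  rw [PiLp.add_apply, mul_add]

/-- `p·(L e_a) = 2π k_a` (`L ≠ 0`). [folklore] -/
theorem phase_single {L : ℝ} (hL : L ≠ 0) (k : Fin 3 → ℤ) (a : Fin 3) :
    2 * Real.pi / L * ∑ i, (k i : ℝ) * (EuclideanSpace.single a L : Space) i =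
      ((k a : ℤ) : ℝ) * (2 * Real.pi) := by
  simp only [PiLp.single_apply, mul_ite, mul_zero, Finset.sum_ite_eq', Finset.mem_univ, if_true]
  field_simp

/-- `cos(p·(x + L e_a)) = cos(p·x)`: the cosine wave is `Lℤ³`-periodic. [folklore] -/
theorem cos_phase_add_single {L : ℝ} (hL : L ≠ 0) (k : Fin 3 → ℤ) (x : Space) (a : Fin 3) :
    Real.cos (2 * Real.pi / L * ∑ i, (k i : ℝ) * (x + EuclideanSpace.single a L) i) =
      Real.cos (2 * Real.pi / L * ∑ i, (k i : ℝ) * x i) := by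
  rw [phase_add, phase_single hL, Real.cos_add_int_mul_two_pi]

/-- The shifted density wave `X ↦ ∑ⱼ cos(p·(xⱼ + s))` is `Lℤ³`-periodic in every particle.
[folklore] -/
theorem sum_cos_phase_shift_add_single {L : ℝ} (hL : L ≠ 0) (k : Fin 3 → ℤ) (s : Space)
    (X : Config N) (i : Fin N) (a : Fin 3) :
    (∑ j, Real.cos (2 * Real.pi / L * ∑ i', (k i' : ℝ) *
        ((X + Pi.single i (EuclideanSpace.single a L) + fun _ => s : Config N) j) i')) =
      ∑ j, Real.cos (2 * Real.pi / L * ∑ i', (k i' : ℝ) * ((X + fun _ => s : Config N) j) i') := by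
  refine Finset.sum_congr rfl fun j _ => ?_
  simp only [Pi.add_apply]
  rcases eq_or_ne j i with rfl | hji
  · rw [Pi.single_eq_same, add_right_comm, cos_phase_add_single hL]
  · rw [Pi.single_eq_of_ne hji, add_zero]

/-- **The quarter-wavelength shift.** For `k ≠ 0` and `s = (L/4|k|²) k`: `p·(x + s) = p·x + π/2`.
[folklore] -/
theorem phase_add_quarterShift {L : ℝ} (hL : L ≠ 0) {k : Fin 3 → ℤ} (hk : k ≠ 0) (x : Space) :
    2 * Real.pi / L * ∑ i, (k i : ℝ) *
        (x + WithLp.toLp 2 fun i => L / (4 * ∑ i', (k i' : ℝ) ^ 2) * (k i : ℝ)) i =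
      2 * Real.pi / L * ∑ i, (k i : ℝ) * x i + Real.pi / 2 := by
  -- adapted from `exists_translate_cosMean_eq_neg` (ModulationToolkit): `|k|² > 0` for `k ≠ 0`
  set κ : ℝ := ∑ i, (k i : ℝ) ^ 2 with hκ
  have hκpos : 0 < κ := by
    obtain ⟨i, hi⟩ : ∃ i, k i ≠ 0 := by
      by_contra h
      push Not at h
      exact hk (funext h)
    have hi' : (0 : ℝ) < (k i : ℝ) ^ 2 := by
      have : (k i : ℝ) ≠ 0 := by exact_mod_cast hi
      positivity
    exact Finset.sum_pos' (fun j _ => sq_nonneg _) ⟨i, Finset.mem_univ _, hi'⟩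
  rw [phase_add]
  congr 1
  have hsum : ∑ i, (k i : ℝ) * (WithLp.toLp 2 fun i => L / (4 * κ) * (k i : ℝ) : Space) i =
      L / (4 * κ) * κ := by
    rw [hκ, Finset.mul_sum]
    refine Finset.sum_congr rfl fun i _ => ?_
    rw [PiLp.toLp_apply]
    ring
  rw [hsum]
  field_simp
  ring

/-! ### The quarter-wavelength translation: sine modes from cosine modes -/

/-- **Sine-mode static response from the cosine one.** In a box `L > 0`, for `k ≠ 0`
(`p = 2πk/L`): if `E₀ - C_K t² ≤ E(Ψ) + t ∫_cell (∑ⱼ cos(p·xⱼ))|Ψ|²` for all real `t` and all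
finite-energy periodic trial states `Ψ`, then also
`E₀ - C_K t² ≤ E(Ψ) + t ∫_cell (∑ⱼ sin(p·xⱼ))|Ψ|²` for all such `t`, `Ψ`. Proof: apply the cosine
bound at coupling `-t` to the translate `Ψ(· - s𝟙)`, `s = (L/4|k|²) k` (same energy), and shift the
cell integral of the periodic integrand back: `cos(p·(x + s)) = cos(p·x + π/2) = -sin(p·x)`.
[folklore] -/
theorem staticResponse_sin_of_cos {v : ℝ → ℝ≥0∞} {L : ℝ} (hL : 0 < L) {k : Fin 3 → ℤ} (hk : k ≠ 0)
    {CK : ℝ}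
    (hK : ∀ (t : ℝ) (Ψ : PeriodicTrialState N L), periodicEnergy v Ψ ≠ ⊤ →
      (periodicGroundStateEnergy v N L).toReal - CK * t ^ 2 ≤
        (periodicEnergy v Ψ).toReal + t * ∫ X in cellN N L,
          (∑ j, Real.cos (2 * Real.pi / L * ∑ i, (k i : ℝ) * X j i)) * ‖Ψ.ψ X‖ ^ 2)
    (t : ℝ) (Ψ : PeriodicTrialState N L) (hΨ : periodicEnergy v Ψ ≠ ⊤) :
    (periodicGroundStateEnergy v N L).toReal - CK * t ^ 2 ≤
      (periodicEnergy v Ψ).toReal + t * ∫ X in cellN N L,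
        (∑ j, Real.sin (2 * Real.pi / L * ∑ i, (k i : ℝ) * X j i)) * ‖Ψ.ψ X‖ ^ 2 := by
  -- adapted from `exists_translate_cosMean_eq_neg` (ModulationToolkit, half-wavelength shift)
  set s : Space := WithLp.toLp 2 fun i => L / (4 * ∑ i', (k i' : ℝ) ^ 2) * (k i : ℝ) with hs
  obtain ⟨Ψ', hΨ'⟩ := Ψ.exists_translate s
  have hE : periodicEnergy v Ψ' = periodicEnergy v Ψ := periodicEnergy_translate v Ψ s hΨ'
  have h := hK (-t) Ψ' (by rw [hE]; exact hΨ)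
  rw [hE] at h
  -- the shifted integrand `G(X) = (∑ⱼ cos(p·(xⱼ + s))) |Ψ(X)|²`, periodic and continuous
  set G : Config N → ℝ := fun X =>
    (∑ j, Real.cos (2 * Real.pi / L * ∑ i, (k i : ℝ) * ((X + fun _ => s : Config N) j) i)) *
      ‖Ψ.ψ X‖ ^ 2 with hG
  have hGper : ∀ (X : Config N) (i : Fin N) (a : Fin 3),
      G (X + Pi.single i (EuclideanSpace.single a L)) = G X := by
    intro X i a
    simp only [hG]
    rw [Ψ.periodic X i a, sum_cos_phase_shift_add_single hL.ne' k s X i a]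
  have hGc : Continuous G := by
    refine Continuous.mul (continuous_finsetSum _ fun j _ => Real.continuous_cos.comp
      (continuous_const.mul (continuous_finsetSum _ fun i _ => continuous_const.mul ?_)))
      ((continuous_norm.comp Ψ.contDiff.continuous).pow 2)
    exact (PiLp.continuous_apply 2 _ i).comp
      ((continuous_apply j).comp (continuous_id.add continuous_const))
  -- `⟨∑ⱼ cos(p·xⱼ)⟩_{Ψ'} = ∫_cell G(X - s𝟙) = ∫_cell G = -⟨∑ⱼ sin(p·xⱼ)⟩_Ψ`
  have hcosΨ' : ∫ X in cellN N L, (∑ j, Real.cos (2 * Real.pi / L * ∑ i, (k i : ℝ) * X j i)) *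
      ‖Ψ'.ψ X‖ ^ 2 = ∫ X in cellN N L, G (X + -fun _ => s) := by
    rw [hΨ']
    congr 1 with X
    simp only [hG, sub_eq_add_neg, Pi.add_apply, Pi.neg_apply, neg_add_cancel_right]
  have hGsin : ∫ X in cellN N L, G X = -∫ X in cellN N L,
      (∑ j, Real.sin (2 * Real.pi / L * ∑ i, (k i : ℝ) * X j i)) * ‖Ψ.ψ X‖ ^ 2 := by
    rw [← integral_neg]
    congr 1 with X
    simp only [hG]
    rw [← neg_mul, ← Finset.sum_neg_distrib]
    congr 1
    refine Finset.sum_congr rfl fun j _ => ?_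
    rw [Pi.add_apply, hs, phase_add_quarterShift hL.ne' hk, Real.cos_add_pi_div_two]
  rw [hcosΨ', setIntegral_cellN_comp_add_of_periodic hL hGc.aestronglyMeasurable hGper,
    hGsin] at h
  linarith

end Summit.AtomisticToContinuum.BoseEinsteinCondensation.Theorems.CorrectorClosure.HealingScaleKacInsertion.ResponseDictionary

namespace Summit.AtomisticToContinuum.BoseEinsteinCondensation.Theorems.CorrectorClosure.HealingScaleKacInsertion

open Literature.MathematicalPhysics.QuantumManyBody.BoseGas
open Summit.AtomisticToContinuum.BoseEinsteinCondensation.Theses.BECInsertionCorrector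
open Summit.AtomisticToContinuum.BoseEinsteinCondensation.Theorems.CorrectorClosure.Negative
  (sideLength_succ_pos)
open ResponseDictionary

/-! ### The registered sub-goal -/

/-- **Sub-goal `responseDictionary_sin` of `stub_kacClosure` (line `healing-scale-kac-insertion`)
— the sine twin of `stub_responseDictionary`.** `StaticResponseBound` gives, for every bounded
repulsive finite-range `v`, thresholds `ρ₁ > 0`, `C > 0` such that for `0 < ρ < ρ₁`, `N ≥ 1`,
`L = ((N+1)/ρ)^{1/3}` with bounded `v^per`, IF the `N`-body bath in that box has a continuous
positive FK ground state `Θ₀`, then every sine density mode `g_k = ∑ⱼ sin(p·xⱼ)`, `p = 2πk/L ≠ 0`,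
has Kipnis–Varadhan norm `hMinusOneSqW L Θ₀ g_k ≤ C N / max(ρ'a, |p|²)`, `ρ' = N/L³ = ρN/(N+1)`
(`ρ₁ := ρ₀(K1)`, same `C` as the cosine modes; K1's cosine bound is turned into the sine bound by
the quarter-wavelength translation `staticResponse_sin_of_cos`). [folklore] -/
theorem responseDictionary_sin (hK1 : StaticResponseBound) (v : ℝ → ℝ≥0∞)
    (hv : IsRepulsiveFiniteRange v) (_hbdd : ∃ C : ℝ≥0, ∀ r, v r ≤ C) :
    ∃ ρ₁ : ℝ, 0 < ρ₁ ∧ ∃ C : ℝ, 0 < C ∧ ∀ ρ : ℝ, 0 < ρ → ρ < ρ₁ → ∀ N : ℕ, 1 ≤ N →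
      (∃ C' : ℝ≥0, ∀ x, periodizedPotential v (sideLength ρ (N + 1)) x ≤ C') →
      IsPeriodicGroundStateFK v (sideLength ρ (N + 1))
          (periodicFKGroundState v N (sideLength ρ (N + 1))) →
      Continuous (periodicFKGroundState v N (sideLength ρ (N + 1))) →
      (∀ X, 0 < periodicFKGroundState v N (sideLength ρ (N + 1)) X) →
      ∀ k : Fin 3 → ℤ, k ≠ 0 →
        hMinusOneSqW (sideLength ρ (N + 1)) (periodicFKGroundState v N (sideLength ρ (N + 1)))
            (fun X : Config N =>
              ∑ j, Real.sin (2 * Real.pi / sideLength ρ (N + 1) * ∑ i, (k i : ℝ) * X j i)) ≤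
          ENNReal.ofReal (C * N /
            max (N / sideLength ρ (N + 1) ^ 3 * (scatteringLength v).toReal)
              ((2 * Real.pi / sideLength ρ (N + 1)) ^ 2 * ∑ i, (k i : ℝ) ^ 2)) := by
  -- mirror of the proof of `stub_responseDictionary` (the cosine twin)
  obtain ⟨ρ₀, hρ₀, C, hC, hK⟩ := hK1 v hv
  refine ⟨ρ₀, hρ₀, C, hC, fun ρ hρ hρ₀' N hN hb hΘ hΘc _hΘp k hk => ?_⟩
  obtain ⟨C', hC'⟩ := hb
  have hL : 0 < sideLength ρ (N + 1) := sideLength_succ_pos hρ N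
  -- (i) box bookkeeping: K1 for the bath at density `ρ' = ρN/(N+1)` in the same box
  have hρ' : 0 < ρ * N / (N + 1) := by
    have : (0 : ℝ) < N := by exact_mod_cast hN
    positivity
  have hρ'lt : ρ * N / (N + 1) < ρ₀ := by
    have h1 : ρ * N / (N + 1) < ρ := by
      rw [div_lt_iff₀ (by positivity)]; nlinarith
    exact h1.trans hρ₀'
  have hKL := hK (ρ * N / (N + 1)) hρ' hρ'lt N k hk
  rw [sideLength_bath hρ hN, density_bath hρ N] at hKL
  set CK : ℝ := C * N / max (N / sideLength ρ (N + 1) ^ 3 * (scatteringLength v).toReal)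
    ((2 * Real.pi / sideLength ρ (N + 1)) ^ 2 * ∑ i, (k i : ℝ) ^ 2) with hCK
  have hKcos : ∀ (t : ℝ) (Ψ : PeriodicTrialState N (sideLength ρ (N + 1))),
      periodicEnergy v Ψ ≠ ⊤ →
      (periodicGroundStateEnergy v N (sideLength ρ (N + 1))).toReal - CK * t ^ 2 ≤
        (periodicEnergy v Ψ).toReal + t * ∫ X in cellN N (sideLength ρ (N + 1)),
          (∑ j, Real.cos (2 * Real.pi / sideLength ρ (N + 1) * ∑ i, (k i : ℝ) * X j i)) *
            ‖Ψ.ψ X‖ ^ 2 := by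
    intro t Ψ hΨ
    have h := hKL t Ψ hΨ
    have e : C * t ^ 2 * N / max (N / sideLength ρ (N + 1) ^ 3 * (scatteringLength v).toReal)
        ((2 * Real.pi / sideLength ρ (N + 1)) ^ 2 * ∑ i, (k i : ℝ) ^ 2) = CK * t ^ 2 := by
      rw [hCK]; ring
    rw [e] at h
    exact h
  -- (ii) the quarter-wavelength translation: the same bound for the sine modes
  have hK' : ∀ (t : ℝ) (Ψ : PeriodicTrialState N (sideLength ρ (N + 1))),
      periodicEnergy v Ψ ≠ ⊤ →
      (periodicGroundStateEnergy v N (sideLength ρ (N + 1))).toReal - CK * t ^ 2 ≤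
        (periodicEnergy v Ψ).toReal + t * ∫ X in cellN N (sideLength ρ (N + 1)),
          (∑ j, Real.sin (2 * Real.pi / sideLength ρ (N + 1) * ∑ i, (k i : ℝ) * X j i)) *
            ‖Ψ.ψ X‖ ^ 2 :=
    fun t Ψ hΨ => staticResponse_sin_of_cos hL hk hKcos t Ψ hΨ
  -- the sine density mode `g_k = ∑ⱼ sin(p·xⱼ)`: continuous, `|g_k| ≤ N`, permutation symmetric
  have hgc : Continuous fun X : Config N =>
      ∑ j, Real.sin (2 * Real.pi / sideLength ρ (N + 1) * ∑ i, (k i : ℝ) * X j i) := by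
    refine continuous_finsetSum _ fun j _ => Real.continuous_sin.comp (continuous_const.mul
      (continuous_finsetSum _ fun i _ => continuous_const.mul ?_))
    exact (PiLp.continuous_apply 2 _ i).comp (continuous_apply j)
  have hgb : ∀ X : Config N,
      |∑ j, Real.sin (2 * Real.pi / sideLength ρ (N + 1) * ∑ i, (k i : ℝ) * X j i)| ≤ N := by
    intro X
    calc |∑ j, Real.sin (2 * Real.pi / sideLength ρ (N + 1) * ∑ i, (k i : ℝ) * X j i)|
        ≤ ∑ j : Fin N, |Real.sin (2 * Real.pi / sideLength ρ (N + 1) * ∑ i, (k i : ℝ) * X j i)| :=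
          Finset.abs_sum_le_sum_abs _ _
      _ ≤ ∑ _j : Fin N, (1 : ℝ) := Finset.sum_le_sum fun j _ => Real.abs_sin_le_one _
      _ = N := by simp
  have hgsymm : ∀ (σ : Equiv.Perm (Fin N)) (X : Config N),
      (∑ j, Real.sin (2 * Real.pi / sideLength ρ (N + 1) * ∑ i, (k i : ℝ) * (X ∘ σ) j i)) =
        ∑ j, Real.sin (2 * Real.pi / sideLength ρ (N + 1) * ∑ i, (k i : ℝ) * X j i) := fun σ X =>
    Equiv.sum_comp σ
      (fun j => Real.sin (2 * Real.pi / sideLength ρ (N + 1) * ∑ i, (k i : ℝ) * X j i))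
  -- (iii) the core
  exact hMinusOneSqW_le_of_fk_staticResponse hv.1 hL hC' hΘ hΘc hgc hgb hgsymm hK'

end Summit.AtomisticToContinuum.BoseEinsteinCondensation.Theorems.CorrectorClosure.HealingScaleKacInsertion

end
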